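import Summits.AtomisticToContinuum.Crystallization.Theorems.FrustratedLawDichotomyAtlasReach
import Summits.AtomisticToContinuum.Crystallization.Theorems.FrustratedLawDichotomyCellF1cRow

/-!
# FrustratedLawDichotomy · crux `AperiodicFrustratedLawGap` (stmt-AtomisticToContinuum-27623) — THE REACH OF THE ONE-ROW ATLAS {F1}
# (decomp-a2c hand-2 g49, structural share; critic r1883 (A) «AtlasReachF1»: the `n = 1` instance of (404) `coherentMassExclusion_univ` on the F1 row)

(404) `…AtlasReach.coherentMassExclusion_univ` turns certified row floors ALONE into a law-level exclusion in the crux's own currency: no admissible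
minimising law is `(1 − reach m D_univ)`-coherent with the atlas.  This file is its ONE-ROW instance on the class-A F1 row of record
#110 `…CellF1cRow.KF1c` (configurations coherent, tolerance `2⁻¹⁰`, window `13`, at the strained complete template `posL F ∘ aF1` on `MF1c` for a rational
strain `F ∈ BF1`), whose `hfloor` line is #110 `hfloor_KF1c_of_cert` — literally the (228)/(404) `hfloor` shape, MODULO the K-certificate interface
`CertF1c YF cUp mc` (the target of the F1 Floor file: `2·(cUp + mc) ≤ certFloorL MF1c MIF1 0 (posF1 F) (YF F) 2⁻¹⁰ 13` on `BF1`).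

* ★ `coherentMassExclusion_F1c` — `e⋆ ≤ cUp → CertF1c YF cUp mc → 0 < mc → CoherentMassExclusion 1 (fun _ => KF1c) (reach mc D_univ)`:
  no admissible minimising law gives the complement of the F1 row mass `< mc/(mc + D_univ)`;
* `aperiodicFrustratedLawGap_of_offAtlasMassGap_F1c` — hence the crux ⟸ its off-{F1} residual `OffAtlasMassGap 1 (fun _ => KF1c) (reach mc D_univ)`;
* `coherentMassExclusion_F1c_mono` — any `η ≤ reach mc D_univ` (e.g. the booked `1/40000` once `mc ≥ 5057/10⁶`, by (404) `reach_F1_univ` + `reach_mono`);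
* `coherentMassExclusion_F1c_record` — the instance at the class-A margin of record `m_A(F1) = 5057/10⁶` (census F1-WIDTH-56): `CertF1c YF cUp (5057/10⁶)`
  with `e⋆ ≤ cUp` excludes every admissible minimising law that is `(1 − 1/40000)`-coherent with {F1}.
HONEST LABEL: every theorem here carries `hcert : CertF1c …` — the F1 K-certificate is NOT yet discharged on the tree (chain of record r1849 (A)(2):
Near column → RM star table → SY → ONE `lb_le_certFloorL_scale` application); the moment it lands these become unconditional by `fun h => … h`.
Imports TREE (404) `…AtlasReach` + #110 `…CellF1cRow` only; plain theorems, no def / instance / option; 0 sorry.  Tags: [new: junction instance].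
-/

noncomputable section

namespace Summit.AtomisticToContinuum.Crystallization.Theorems.FrustratedLawDichotomyAtlasReachF1

open MeasureTheory
open Summit.AtomisticToContinuum.Crystallization.Theorems.ChargedEnergyGapNegative (E3 eStar)
open Summit.AtomisticToContinuum.Crystallization.Theorems.FrustratedLawDichotomyAtlasReach
  (reach Duniv Duniv_nonneg reach_mono CoherentMassExclusion OffAtlasMassGap coherentMassExclusion_univ coherentMassExclusion_anti
    aperiodicFrustratedLawGap_of_massSplit reach_F1_univ)
open Summit.AtomisticToContinuum.Crystallization.Theorems.FrustratedLawDichotomyCellF1cRow (KF1c measurableSet_KF1c CertF1c hfloor_KF1c_of_cert)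

variable {YF : Matrix (Fin 3) (Fin 3) ℝ → ℤ × ℤ × ℤ → E3} {cUp mc : ℝ}

/-- ★ **REACH OF THE ONE-ROW ATLAS {F1}** (modulo the K-certificate): if `e⋆ ≤ cUp` and `CertF1c YF cUp mc` with `0 < mc`, then no admissible minimising
law gives the complement of the F1 row of record `KF1c` mass `< reach mc D_univ = mc/(mc + D_univ)` — (404) `coherentMassExclusion_univ` at `n = 1` with
`hfloor :=` #110 `hfloor_KF1c_of_cert`. [new: junction instance] -/
theorem coherentMassExclusion_F1c (hc : eStar ≤ cUp) (hcert : CertF1c YF cUp mc) (hmc : 0 < mc) :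
    CoherentMassExclusion 1 (fun _ => KF1c) (reach mc Duniv) :=
  coherentMassExclusion_univ 1 (fun _ => KF1c) (fun _ => measurableSet_KF1c) (fun _ => mc)
    (fun _ _ μ hμ hN hrow => hfloor_KF1c_of_cert hc hcert μ hμ hN hrow) hmc fun _ _ => le_rfl

/-- the same for every smaller threshold `η ≤ reach mc D_univ`. [new: bookkeeping] -/
theorem coherentMassExclusion_F1c_mono (hc : eStar ≤ cUp) (hcert : CertF1c YF cUp mc) (hmc : 0 < mc) {η : ℝ} (hη : η ≤ reach mc Duniv) :
    CoherentMassExclusion 1 (fun _ => KF1c) η :=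
  coherentMassExclusion_anti hη (coherentMassExclusion_F1c hc hcert hmc)

/-- ★ hence (modulo the K-certificate) the crux ⟸ its off-{F1} residual: an admissible minimising law must put mass `≥ reach mc D_univ` OFF the F1 row.
[new: junction instance] -/
theorem aperiodicFrustratedLawGap_of_offAtlasMassGap_F1c (hc : eStar ≤ cUp) (hcert : CertF1c YF cUp mc) (hmc : 0 < mc)
    (hA : OffAtlasMassGap 1 (fun _ => KF1c) (reach mc Duniv)) :
    Summit.AtomisticToContinuum.Crystallization.Theses.FrustratedLawDichotomy.AperiodicFrustratedLawGap :=
  aperiodicFrustratedLawGap_of_massSplit 1 (fun _ => KF1c) _ (coherentMassExclusion_F1c hc hcert hmc) hA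

/-- a larger certified margin only widens the excluded class: `CertF1c YF cUp mc` with `m ≤ mc`, `0 < m` gives F(reach m D_univ). [new: bookkeeping] -/
theorem coherentMassExclusion_F1c_of_le (hc : eStar ≤ cUp) (hcert : CertF1c YF cUp mc) {m : ℝ} (hm0 : 0 < m) (hm : m ≤ mc) :
    CoherentMassExclusion 1 (fun _ => KF1c) (reach m Duniv) :=
  coherentMassExclusion_F1c_mono hc hcert (lt_of_lt_of_le hm0 hm) (reach_mono hm0 hm Duniv_nonneg)

/-- ★ THE INSTANCE AT THE MARGIN OF RECORD `m_A(F1) = 5057/10⁶` (census F1-WIDTH-56): a K-certificate of the F1 row with margin `≥ 5057/10⁶` excludes,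
with NO residual hypothesis, every admissible minimising law that is `(1 − 1/40000)`-coherent with the one-row atlas {F1} ((404) `reach_F1_univ`:
`1/40000 < reach (5057/10⁶) D_univ`). [new: numerical instance] -/
theorem coherentMassExclusion_F1c_record (hc : eStar ≤ cUp) (hcert : CertF1c YF cUp mc) (hmc : (5057 : ℝ) / 1000000 ≤ mc) :
    CoherentMassExclusion 1 (fun _ => KF1c) (1 / 40000) :=
  coherentMassExclusion_anti reach_F1_univ.1.le (coherentMassExclusion_F1c_of_le hc hcert (by norm_num) hmc)

end Summit.AtomisticToContinuum.Crystallization.Theorems.FrustratedLawDichotomyAtlasReachF1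

end
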